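import Summits.HodgeConjecture.HodgeConjecture.Theorems.CorCMDominationCommonField
import Summits.HodgeConjecture.CorCM.Model.CMDominationGuard
import Literature.AlgebraicGeometry.ComplexMultiplication.ShimuraIsogenousPowerOfRiemann
import Literature.AlgebraicGeometry.Motives.AbelianVarietyDimZeroProofs
import Literature.NumberTheory.Automorphic.ConjugateSelfDualCharacters
import HarnessLib

/-!
# COR-CM row M20 beyond the codes: EVERY complex abelian variety of CM type is dominated by a product
# `∏_j A_{(F,Θ_j)}` over one Galois CM field `F` of degree `≥ 6` — modulo Riemann's theorem only

Cell `pub-hodgecm2` (COR-CM = Hodge ladder stage 2), seat b18 (row M20 `Fact_cmDominated`). The coded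
instance of M20 (`Domination.coded_cmDominated`, consumed by `Model.universeOf_fact_cmDominated`) covers the
CM-flagged codes of the Picard–CM index type. This file proves the same domination for an ARBITRARY
complex abelian variety `A` of CM type (`Milne1999.IsOfCMType A`), which is what the iso-complete second
model `Model2.universe₂` (its M14/M20 row) and Lemma 8.2 of rfwf v3 (`Universe.Lemma81`, "X CM ⇒ X an
isogeny factor of `∏ A_{(F,Θ_j)}` over ONE Galois `F`, degree raised by enlarging `F`") literally ask for:

* `AVDominatedBy.of_dim_eq_zero` — a `0`-dimensional abelian variety is dominated by anything (`𝟙 A = 0`,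
  the tree's `AbelianVariety.hom_eq_zero_of_dim_eq_zero_left`), which settles the degenerate case that makes
  the UNGUARDED coding hypothesis `hDom` of `Domination.cmDominated_of_isOfCMType` refutable (cell finding
  b11, `Model.not_hDom`: the trivial abelian variety is of CM type and isogenous to no CM-flagged code);
* `avDominatedBy_cmProd_of_isOfCMType_pos`, `cmDominated_of_isOfCMType_pos` — the tree's
  `avDominatedBy_cmProd_of_isOfCMType` / `cmDominated_of_isOfCMType` re-run on the GUARDED coding hypothesis
  `hDomPos` (`0 < A.dim`; verbatim the binder of the tree's `Milne1999.forall_cmHodgeHypothesisAt_of_codesHC_pos`);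
* `cmDominated_of_isOfCMType_all` — all dimensions, over `hd`, `hcor`, `hDomPos`;
* `cmDominated_of_isOfCMType_all_of_riemann`, `avDominatedBy_cmProd_of_isOfCMType_pos_of_riemann` — the same
  on the DISPLAYED binders of the top statement `HC_CM_of_PerLFace`: Riemann's theorem
  `hR : DeligneMilne1982_Thm_6_20_full` (row B02) and the records `hU`, `h₃`; the Shimura inputs come from
  `thm3_isogenousPower_of_riemann hR h₃`, `thm2_cor_of_riemann hR`, the guarded coding from the cell's
  `Model.hDomPos_of_riemann` (`CorCM/Model/CMDominationGuard.lean`, seat b11: the tree chain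
  `Milne1999.hDomPos_of_hDecompPos ∘ hDecompPos_of_hSimplePos ∘ hSimplePos_of_riemann`).

So: **for every complex abelian variety `A` of CM type there are a Galois CM field `F` with `6 ≤ [F:ℚ]`,
CM types `Θ₀, …, Θ_n` of `F`, homomorphisms `s : A → ∏_j A_{(F,Θ_j)}`, `π : ∏_j A_{(F,Θ_j)} → A` and
`N ≠ 0` with `π ∘ s = [N]_A`** — KERNEL modulo B02 (`#print axioms` = the standard trio). The degree bound
holds for every `A` including CM elliptic curves and CM surfaces because `F = commonField v` receives
`ℚ(ζ₇)` (`Domination.six_le_finrank_commonField`); at dimension `0` we take `F = ℚ(ζ₇)` itself.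

References: G. Shimura, *Abelian Varieties with Complex Multiplication and Modular Functions* (1998),
§5.1 Props. 3–6, §6.1 Corollary of Theorem 2 (p. 41), §6.2 Theorem 3 (pp. 41–43), §7.1 Prop. 7,
§18.2 Lemma (ii)–(iii); D. Mumford, *Abelian Varieties* (1970), §19 (Poincaré complete reducibility);
P. Deligne, J. S. Milne, *Tannakian Categories*, LNM 900 (1982), Thm. 6.20 (Riemann), print p. 212.
-/

noncomputable section

open CategoryTheory IntermediateField NumberField
open Literature.AlgebraicGeometry.Motives Literature.AlgebraicGeometry.HodgeTheory
open Literature.AlgebraicGeometry.ComplexMultiplication Literature.AlgebraicGeometry.Milne1999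
open Literature.NumberTheory.Automorphic
open Literature.NumberTheory.Automorphic.PicardCM (BallQuotientUniformisedDatum CMAbelianVarietyRealised)

namespace Summit.HodgeConjecture.CorCM.Domination

/-! ### Dimension zero -/

/-- **A `0`-dimensional abelian variety is dominated by every abelian variety**: `𝟙 A = 0`
(`AbelianVariety.hom_eq_zero_of_dim_eq_zero_left`), so `s = 0`, `π = 0`, `N = 1` work. [folklore] -/
theorem AVDominatedBy.of_dim_eq_zero (A P : AbelianVariety ℂ) (h : A.dim = 0) : AVDominatedBy A P := by
  refine ⟨0, 0, 1, one_ne_zero, ?_⟩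
  rw [Limits.zero_comp, one_smul]
  exact (AbelianVariety.hom_eq_zero_of_dim_eq_zero_left A h (𝟙 A)).symm

/-! ### An auxiliary Galois CM field of degree `6`, for the degenerate case -/

/-- `ℚ(ζ₇)` is Galois over `ℚ` (a cyclotomic, hence normal and separable, extension). [folklore] -/
theorem isGalois_cyclotomic7 : IsGalois ℚ (CyclotomicField 7 ℚ) := by
  haveI : IsCyclotomicExtension {7} ℚ (CyclotomicField 7 ℚ) := by
    convert CyclotomicField.isCyclotomicExtension 7 ℚ <;> rfl
  exact IsCyclotomicExtension.isGalois {7} ℚ (CyclotomicField 7 ℚ)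

/-! ### Positive dimension: the guarded coding hypothesis `hDomPos` -/

/-- **Every complex abelian variety of CM type and positive dimension is dominated by a product
`∏_j A_{(F,Θ_j)}`** over any CM field `F` receiving the leaf fields of a coded model of `A` — the tree's
`avDominatedBy_cmProd_of_isOfCMType` on the GUARDED coding hypothesis `hDomPos` (CM domination by realised
codes up to isogeny at positive dimension; verbatim the binder of
`Milne1999.forall_cmHodgeHypothesisAt_of_codesHC_pos`), followed by `coded_avDominatedBy` and isogeny
transport. [cite: Shimura1998, §5.1 Props. 1, 3, 4 and §6.1 Corollary of Theorem 2 (p. 41)] -/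
theorem avDominatedBy_cmProd_of_isOfCMType_pos (hU : BallQuotientUniformisedDatum) (h₃ : CMAbelianVarietyRealised)
    (hd : Shimura1998_Thm3_isogenousPower)
    (hcor : Shimura1998_Thm2_Cor)
    (hDomPos : ∀ A : AbelianVariety ℂ, 0 < A.dim → IsOfCMType A →
      ∃ (v : PicardCM.Var) (B : AbelianVariety ℂ), PicardCM.Var.IsCMAbelianVariety h₃ v ∧
        B.X = PicardCM.Var.scheme hU h₃ v ∧ AbelianVariety.IsIsogenous A B)
    (A : AbelianVariety ℂ) (hA0 : 0 < A.dim) (hCM : IsOfCMType A) :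
    ∃ v : PicardCM.Var, PicardCM.Var.IsCMAbelianVariety h₃ v ∧
      ∀ (F : Type) [Field F] [NumberField F] [IsCMField F], LeafEmbeddable F v →
        ∃ (n : ℕ) (Θ : Fin (n + 1) → CMType F), AVDominatedBy A (cmProdAV F h₃ n Θ) := by
  obtain ⟨v, B, hv, hB, hAB⟩ := hDomPos A hA0 hCM
  refine ⟨v, hv, fun F _ _ _ hF => ?_⟩
  obtain ⟨n, Θ, h⟩ := (coded_avDominatedBy hU h₃ hd hcor v hv hF B hB).1
  exact ⟨n, Θ, AVDominatedBy.of_isIsogenous hAB h⟩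

/-- **M14/M20 for an arbitrary complex abelian variety of CM type and positive dimension**, over the
guarded coding hypothesis: `A` is dominated by `∏_j A_{(F,Θ_j)}` over a Galois CM field `F` with
`6 ≤ [F:ℚ]` (the common field of a coded model of `A`).
[cite: Shimura1998, §5.1 Props. 1, 3, 4, §6.1 Corollary of Theorem 2, §6.2 Theorem 3, §18.2 Lemma (ii)–(iii)] -/
theorem cmDominated_of_isOfCMType_pos (hU : BallQuotientUniformisedDatum) (h₃ : CMAbelianVarietyRealised)
    (hd : Shimura1998_Thm3_isogenousPower) (hcor : Shimura1998_Thm2_Cor)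
    (hDomPos : ∀ A : AbelianVariety ℂ, 0 < A.dim → IsOfCMType A →
      ∃ (v : PicardCM.Var) (B : AbelianVariety ℂ), PicardCM.Var.IsCMAbelianVariety h₃ v ∧
        B.X = PicardCM.Var.scheme hU h₃ v ∧ AbelianVariety.IsIsogenous A B)
    (A : AbelianVariety ℂ) (hA0 : 0 < A.dim) (hCM : IsOfCMType A) :
    ∃ (F : Type) (_ : Field F) (_ : NumberField F) (_ : IsCMField F),
      IsGalois ℚ F ∧ 6 ≤ Module.finrank ℚ F ∧
        ∃ (n : ℕ) (Θ : Fin (n + 1) → CMType F), AVDominatedBy A (cmProdAV F h₃ n Θ) := by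
  obtain ⟨v, -, hF⟩ := avDominatedBy_cmProd_of_isOfCMType_pos hU h₃ hd hcor hDomPos A hA0 hCM
  exact ⟨commonField v, inferInstance, inferInstance, inferInstance, isGalois_commonField v,
    six_le_finrank_commonField v, hF (commonField v) (leafEmbeddable_commonField v)⟩

/-- **M14/M20 for EVERY complex abelian variety of CM type** (all dimensions), over `hd`, `hcor` and the
guarded coding hypothesis `hDomPos`: at dimension `0` take `F = ℚ(ζ₇)` and any CM type of it
(`IdeleClassGroup.cmTypeOf`; `AVDominatedBy.of_dim_eq_zero`); at positive dimension `cmDominated_of_isOfCMType_pos`.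
[cite: Shimura1998, §5.1, §6.1 Corollary of Theorem 2, §6.2 Theorem 3, §18.2 Lemma (ii)–(iii)] -/
theorem cmDominated_of_isOfCMType_all (hU : BallQuotientUniformisedDatum) (h₃ : CMAbelianVarietyRealised)
    (hd : Shimura1998_Thm3_isogenousPower) (hcor : Shimura1998_Thm2_Cor)
    (hDomPos : ∀ A : AbelianVariety ℂ, 0 < A.dim → IsOfCMType A →
      ∃ (v : PicardCM.Var) (B : AbelianVariety ℂ), PicardCM.Var.IsCMAbelianVariety h₃ v ∧
        B.X = PicardCM.Var.scheme hU h₃ v ∧ AbelianVariety.IsIsogenous A B)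
    (A : AbelianVariety ℂ) (hCM : IsOfCMType A) :
    ∃ (F : Type) (_ : Field F) (_ : NumberField F) (_ : IsCMField F),
      IsGalois ℚ F ∧ 6 ≤ Module.finrank ℚ F ∧
        ∃ (n : ℕ) (Θ : Fin (n + 1) → CMType F), AVDominatedBy A (cmProdAV F h₃ n Θ) := by
  rcases Nat.eq_zero_or_pos A.dim with hA0 | hA0
  · haveI : IsCMField (CyclotomicField 7 ℚ) := isCMField_cyclotomic7
    -- a CM type of `ℚ(ζ₇)`: at every (complex) place the embedding with negative exponent for the
    -- constant ∞-type `1` (the tree's `IdeleClassGroup.cmTypeOf`)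
    let Φ : CMType (CyclotomicField 7 ℚ) := IdeleClassGroup.cmTypeOf _ (fun _ => 1) fun _ => one_ne_zero
    exact ⟨CyclotomicField 7 ℚ, inferInstance, inferInstance, isCMField_cyclotomic7, isGalois_cyclotomic7,
      finrank_cyclotomic7.ge, 0, fun _ => Φ, AVDominatedBy.of_dim_eq_zero A _ hA0⟩
  · exact cmDominated_of_isOfCMType_pos hU h₃ hd hcor hDomPos A hA0 hCM

/-! ### On the displayed binders: Riemann's theorem `hR` (row B02) and the records `hU`, `h₃` -/

/-- **Every complex abelian variety of CM type is dominated by `∏_j A_{(F,Θ_j)}` over a Galois CM field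
`F` of degree `≥ 6` — modulo Riemann's theorem only** (Shimura–Taniyama + Poincaré: the geometric input of
rfwf v3 Lemma 8.2 / `Universe.Lemma81` for ARBITRARY CM `A`; the degree bound "by enlarging `F`" is built
in, small CM fields — CM elliptic curves, CM surfaces — being induced to the common field, which
receives `ℚ(ζ₇)`). Inputs: `thm3_isogenousPower_of_riemann hR h₃`, `thm2_cor_of_riemann hR`,
`Model.hDomPos_of_riemann`. [cite: Shimura1998, §5.1 Props. 3–6, §6.1 Corollary of Theorem 2 (p. 41),
§6.2 Theorem 3 (pp. 41–43), §7.1 Prop. 7, §18.2 Lemma (ii)–(iii)]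
[cite: DeligneMilne1982Tannakian, §6 Thm. 6.20 (Riemann), print p. 212] -/
theorem cmDominated_of_isOfCMType_all_of_riemann (hR : DeligneMilne1982_Thm_6_20_full)
    (hU : BallQuotientUniformisedDatum) (h₃ : CMAbelianVarietyRealised)
    (A : AbelianVariety ℂ) (hCM : IsOfCMType A) :
    ∃ (F : Type) (_ : Field F) (_ : NumberField F) (_ : IsCMField F),
      IsGalois ℚ F ∧ 6 ≤ Module.finrank ℚ F ∧
        ∃ (n : ℕ) (Θ : Fin (n + 1) → CMType F), AVDominatedBy A (cmProdAV F h₃ n Θ) :=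
  cmDominated_of_isOfCMType_all hU h₃ (thm3_isogenousPower_of_riemann hR h₃) (thm2_cor_of_riemann hR)
    (Model.hDomPos_of_riemann hR hU h₃) A hCM

/-- The coded-model form on the displayed binders, positive dimension: a coded model `v` of `A` whose
every leaf-receiving CM field `F` dominates `A` by some `∏_j A_{(F,Θ_j)}` (for consumers who choose `F`).
[cite: Shimura1998, §5.1, §6.1 Corollary of Theorem 2, §6.2 Theorem 3]
[cite: DeligneMilne1982Tannakian, §6 Thm. 6.20 (Riemann)] -/
theorem avDominatedBy_cmProd_of_isOfCMType_pos_of_riemann (hR : DeligneMilne1982_Thm_6_20_full)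
    (hU : BallQuotientUniformisedDatum) (h₃ : CMAbelianVarietyRealised)
    (A : AbelianVariety ℂ) (hA0 : 0 < A.dim) (hCM : IsOfCMType A) :
    ∃ v : PicardCM.Var, PicardCM.Var.IsCMAbelianVariety h₃ v ∧
      ∀ (F : Type) [Field F] [NumberField F] [IsCMField F], LeafEmbeddable F v →
        ∃ (n : ℕ) (Θ : Fin (n + 1) → CMType F), AVDominatedBy A (cmProdAV F h₃ n Θ) :=
  avDominatedBy_cmProd_of_isOfCMType_pos hU h₃ (thm3_isogenousPower_of_riemann hR h₃) (thm2_cor_of_riemann hR)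
    (Model.hDomPos_of_riemann hR hU h₃) A hA0 hCM

end Summit.HodgeConjecture.CorCM.Domination

end
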